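import Summits.QuantumFields.YangMills.Theorems.ColdStartUniversalityLatticeLangevinTimeAverageCLT
import Summits.QuantumFields.YangMills.Theorems.ColdStartUniversalityLatticeLangevinBatchMeansInMeasure
import HarnessLib

/-!
# Route `ColdStartUniversality` (fixed-cut-off SZZ dynamics, sampler package): ★★★ THE STUDENTISED CENTRAL LIMIT THEOREM —
# `√T (Ā_T − μ_(β')G) / σ̂_T ⇒ N(0, 1)`: batch-means error bars from ONE cold-start run are asymptotically exact Gaussian confidence intervals

Helper file (seat `ym-line-csu-p1`, g35; `--supports stmt-QuantumFields-24809`).  The practitioners' recipe for a lattice Langevin simulation is: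
run once from the cold start for time `T`, report the time average `Ā_T = T⁻¹∫₀ᵀ G(U_r)dr` with the error bar `σ̂_T/√T`, `σ̂²_T` the centred
batch-means estimator, and read `Ā_T ± 1.96 σ̂_T/√T` as a 95% confidence interval for `μ_(β')(G)`.  At fixed cut-off this is now a THEOREM for
the SU(2) SZZ dynamics: for every coupling, every realising kernel family, EVERY strong solution from EVERY deterministic start on ANY space, every
continuous `|G| ≤ 1` with `σ²(G) = 2∫₀^∞⟨Ĝ,κ_tĜ⟩_μ dt > 0`, and every block scheme `b_n → ∞`, `J_n → ∞`, `b_n/J_n → 0` (`T_n = J_n b_n`),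

  `√T_n (Ā_(T_n) − μ_(β')G) / σ̂_n  →  N(0, 1)`  IN DISTRIBUTION   (★★★ `studentised_timeAverage_clt`),

where `σ̂²_n = (b_n/J_n)Σ_(j<J_n)(a_j − ā)²` is computed from the data alone (block averages `a_j` of `G`).  Proof: the time-average CLT (file 94c:
`√T(Ā_T − μG) ⇒ √σ²·Y`, `Y ~ N(0,1)`), consistency in probability of `σ̂²` (file 95a), Slutsky's theorem with the continuous map
`(x, y) ↦ x / max(√y, √σ²/2)` (Mathlib `TendstoInDistribution.continuous_comp_prodMk_of_tendstoInMeasure_const`), and removal of the truncation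
on the event `{σ̂² ≥ σ²/4}` of probability `→ 1` (`tendstoInDistribution_of_tendstoInMeasure_sub`).  THEOREMS ONLY, no definition, no sorry;
[folklore].  HONEST FRAMING: fixed cut-off; `σ²(G)` and the rate depend on `L, β'`; asymptotic statement (no finite-`T` coverage guarantee);
`UniformColdStartMixing` (24809) is NOT restated; no crux, rung or summit statement is proved; the Yang–Mills mass gap is NOT proved.
-/

set_option autoImplicit false

noncomputable section

namespace Summit.QuantumFields.YangMills.Theorems.ColdStartUniversality

open MeasureTheory ProbabilityTheory Filter Topology Set
open scoped NNReal ENNReal BigOperators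
open Literature Literature.Probability.Process Literature.MathematicalPhysics.QuantumFieldTheory
open Literature.MathematicalPhysics.QuantumLattice (fundamentalRep fundamentalLatticeRep continuous_fundamentalRep)

variable {L : ℕ} [NeZero L]

/-- ★★★ **STUDENTISED CLT: batch-means confidence intervals are asymptotically exact** (every coupling, every start, every realisation, every
continuous observable with `σ²(G) > 0`, every admissible block scheme).  See the module docstring. [folklore] -/
theorem studentised_timeAverage_clt (L : ℕ) [NeZero L] (β' : ℝ)
    (κ : ℝ≥0 → Kernel (GaugeConfig 3 L (Matrix.specialUnitaryGroup (Fin 2) ℂ))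
      (GaugeConfig 3 L (Matrix.specialUnitaryGroup (Fin 2) ℂ))) [∀ t, IsMarkovKernel (κ t)]
    (hreal : ∀ (t : ℝ≥0) (x : GaugeConfig 3 L (Matrix.specialUnitaryGroup (Fin 2) ℂ))
        (Ω : Type) [MeasurableSpace Ω] (P : Measure Ω) [IsProbabilityMeasure P]
        (W : ℝ≥0 → Ω → (Edge 3 L × NoiseIdx 2 → ℝ)) (hW : IsFlatBrownian W P)
        (U : ℝ≥0 → Ω → GaugeConfig 3 L (Matrix.specialUnitaryGroup (Fin 2) ℂ)),
        (∀ ω, U 0 ω = x) →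
        (latticeLangevinDynamics (fundamentalLatticeRep 2) β').IsSolution (fundamentalRep (Fin 2))
          hW.natFiltration P W U →
        κ t x = P.map (U t))
    (x : GaugeConfig 3 L (Matrix.specialUnitaryGroup (Fin 2) ℂ))
    {Ω : Type} [MeasurableSpace Ω] {P : Measure Ω} [IsProbabilityMeasure P]
    {W : ℝ≥0 → Ω → (Edge 3 L × NoiseIdx 2 → ℝ)} (hW : IsFlatBrownian W P)
    {U : ℝ≥0 → Ω → GaugeConfig 3 L (Matrix.specialUnitaryGroup (Fin 2) ℂ)} (hU0 : ∀ ω, U 0 ω = x)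
    (hU : (latticeLangevinDynamics (fundamentalLatticeRep 2) β').IsSolution (fundamentalRep (Fin 2)) hW.natFiltration P W U)
    {G : GaugeConfig 3 L (Matrix.specialUnitaryGroup (Fin 2) ℂ) → ℝ} (hGc : Continuous G) (hG1 : ∀ z, |G z| ≤ 1)
    (hσpos : 0 < 2 * ∫ t in Ioi (0 : ℝ),
        (∫ y, (G y - ∫ z, G z ∂(wilsonMeasure (d := 3) (L := L) (fundamentalRep (Fin 2)) β')) *
          (∫ z, (G z - ∫ z', G z' ∂(wilsonMeasure (d := 3) (L := L) (fundamentalRep (Fin 2)) β')) ∂(κ t.toNNReal y))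
          ∂(wilsonMeasure (d := 3) (L := L) (fundamentalRep (Fin 2)) β')))
    (b : ℕ → ℝ) (J : ℕ → ℕ) (hb : ∀ n, 0 < b n) (hJ : ∀ n, 1 ≤ J n)
    (hb_top : Tendsto b atTop atTop) (hJ_top : Tendsto (fun n => (J n : ℝ)) atTop atTop)
    (hbJ : Tendsto (fun n => b n / J n) atTop (𝓝 0))
    (Ω' : Type) [MeasurableSpace Ω'] (P' : Measure Ω') [IsProbabilityMeasure P'] (Y : Ω' → ℝ) (hY : HasLaw Y (gaussianReal 0 1) P') :
    TendstoInDistribution (fun (n : ℕ) ω =>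
        ((Real.sqrt ((J n : ℝ) * b n))⁻¹ * ∫ r in Ioc (0 : ℝ) ((J n : ℝ) * b n),
            (G (U r.toNNReal ω) - ∫ z, G z ∂(wilsonMeasure (d := 3) (L := L) (fundamentalRep (Fin 2)) β'))) /
          Real.sqrt (b n / J n * ∑ j ∈ Finset.range (J n),
            ((∫ r in Ioc ((j : ℝ) * b n) (((j : ℝ) + 1) * b n), G (U r.toNNReal ω)) / b n -
              ((J n : ℝ) * b n)⁻¹ * ∑ j' ∈ Finset.range (J n), ∫ r in Ioc ((j' : ℝ) * b n) (((j' : ℝ) + 1) * b n), G (U r.toNNReal ω)) ^ 2))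
      atTop Y (fun _ => P) P' := by
  classical
  set μ : Measure (GaugeConfig 3 L (Matrix.specialUnitaryGroup (Fin 2) ℂ)) :=
    wilsonMeasure (d := 3) (L := L) (fundamentalRep (Fin 2)) β' with hμ
  set m : ℝ := ∫ z, G z ∂μ with hm
  set σ2 : ℝ := 2 * ∫ t in Ioi (0 : ℝ), (∫ y, (G y - m) * (∫ z, (G z - m) ∂(κ t.toNNReal y)) ∂μ) with hσ2
  have hσ : 0 < σ2 := hσpos
  have hσ0 : 0 ≤ σ2 := hσ.le
  have hsσ : 0 < Real.sqrt σ2 := Real.sqrt_pos.2 hσ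
  -- the three sequences: `X n` (normalised time average), `est n` (batch means), `S n` (studentised statistic)
  set T : ℕ → ℝ := fun n => (J n : ℝ) * b n with hT
  set X : ℕ → Ω → ℝ := fun n ω => (Real.sqrt (T n))⁻¹ * ∫ r in Ioc (0 : ℝ) (T n), (G (U r.toNNReal ω) - m) with hX
  set est : ℕ → Ω → ℝ := fun n ω => b n / J n * ∑ j ∈ Finset.range (J n),
      ((∫ r in Ioc ((j : ℝ) * b n) (((j : ℝ) + 1) * b n), G (U r.toNNReal ω)) / b n -
        ((J n : ℝ) * b n)⁻¹ * ∑ j' ∈ Finset.range (J n), ∫ r in Ioc ((j' : ℝ) * b n) (((j' : ℝ) + 1) * b n), G (U r.toNNReal ω)) ^ 2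
    with hest
  set S : ℕ → Ω → ℝ := fun n ω => X n ω / Real.sqrt (est n ω) with hS
  have hTtop : Tendsto T atTop atTop := by
    refine tendsto_atTop_mono (fun n => ?_) hb_top
    have h1 : (1 : ℝ) ≤ J n := by exact_mod_cast hJ n
    simp only [hT]; nlinarith [hb n]
  /- ### 1. The CLT for `X n` with limit `√σ² · Y` -/
  set Z : Ω' → ℝ := fun ω' => Real.sqrt σ2 * Y ω' with hZ
  have hZlaw : HasLaw Z (gaussianReal 0 σ2.toNNReal) P' := by
    have h := gaussianReal_const_mul hY (Real.sqrt σ2)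
    have h0 : Real.sqrt σ2 * 0 = 0 := mul_zero _
    have hv : (NNReal.mk (Real.sqrt σ2 ^ 2) (sq_nonneg _)) * 1 = σ2.toNNReal := by
      ext; simp [Real.sq_sqrt hσ0, Real.coe_toNNReal _ hσ0]
    rw [h0, hv] at h
    exact h
  have hclt := (timeAverage_clt L β' κ hreal x hW hU0 hU hGc hG1 (σ2 := σ2) rfl).2.2 Ω' P' Z hZlaw T hTtop
  /- ### 2. Consistency of the estimator in probability -/
  obtain ⟨-, hestm, hestP⟩ := tendstoInMeasure_centredBatchMeans L β' κ hreal x hW hU0 hU hGc hG1 (σ2 := σ2) rfl b J hb hJ hb_top hJ_top hbJ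
  /- ### 3. Slutsky with the truncated quotient `g(x, y) = x / max(√y, √σ²/2)` -/
  set g : ℝ × ℝ → ℝ := fun p => p.1 / max (Real.sqrt p.2) (Real.sqrt σ2 / 2) with hg
  have hgc : Continuous g :=
    continuous_fst.div (continuous_snd.sqrt.max continuous_const) fun p => (lt_max_of_lt_right (by positivity)).ne'
  have hslutsky := hclt.continuous_comp_prodMk_of_tendstoInMeasure_const hgc hestP hestm
  have hlim : (fun ω' => g (Z ω', σ2)) = Y := funext fun ω' => by
    simp only [hg, hZ]
    rw [max_eq_left (by linarith)]
    field_simp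
  rw [hlim] at hslutsky
  /- ### 4. Removing the truncation: `S n − g(X n, est n) → 0` in probability -/
  have hest0 : ∀ n ω, 0 ≤ est n ω := fun n ω => by
    simp only [hest]; exact mul_nonneg (div_nonneg (hb n).le (Nat.cast_nonneg _)) (Finset.sum_nonneg fun j _ => sq_nonneg _)
  have hsub : TendstoInMeasure P (S - fun n ω => g (X n ω, est n ω)) atTop 0 := by
    rw [tendstoInMeasure_iff_norm]
    intro ε hε
    have h34 : (0 : ℝ) < 3 * σ2 / 4 := by positivity
    have hP := (tendstoInMeasure_iff_norm.1 hestP) (3 * σ2 / 4) h34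
    refine tendsto_of_tendsto_of_tendsto_of_le_of_le tendsto_const_nhds hP (fun n => bot_le) fun n => ?_
    refine measure_mono fun ω hω => ?_
    simp only [Set.mem_setOf_eq, Pi.sub_apply, Pi.zero_apply, sub_zero] at hω ⊢
    -- if `est ≥ σ²/4` the two statistics agree, contradicting `ε ≤ ‖…‖`
    by_contra hlt
    push Not at hlt
    have hge : σ2 / 4 ≤ est n ω := by
      rw [Real.norm_eq_abs] at hlt
      have := abs_lt.1 hlt
      linarith
    have hsq : Real.sqrt σ2 / 2 ≤ Real.sqrt (est n ω) := by
      rw [show Real.sqrt σ2 / 2 = Real.sqrt (σ2 / 4) by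
        rw [show σ2 / 4 = σ2 / 2 ^ 2 by norm_num, Real.sqrt_div' _ (by norm_num : (0:ℝ) ≤ 2 ^ 2), Real.sqrt_sq (by norm_num : (0 : ℝ) ≤ 2)]]
      exact Real.sqrt_le_sqrt hge
    have heq : S n ω = g (X n ω, est n ω) := by
      simp only [hS, hg]; rw [max_eq_left hsq]
    rw [heq, sub_self, norm_zero] at hω
    linarith
  have hSm : ∀ n, AEMeasurable (S n) P := fun n =>
    (hclt.forall_aemeasurable n).div (hestm n).sqrt
  exact tendstoInDistribution_of_tendstoInMeasure_sub S Y hslutsky hsub hSm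

end Summit.QuantumFields.YangMills.Theorems.ColdStartUniversality

end
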